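import Mathlib
import Summits.Ventures.PercRepro2.CoinOrTailKDefs
import Summits.Ventures.PercRepro2.CoinOrTailKSums
import Summits.Ventures.PercRepro2.CoinOrTailKAlg
import Summits.Ventures.PercRepro2.CoinOrTailKCore
import Summits.Ventures.PercRepro2.CoinOrTailKOneAlg

/-!
# The k-entry OR-tail split at a SET of entries whose traces form a chain (blind cell PercRepro2,
night-2 g11; proofs/NIGHT2-DARC.md §45)

For a subset `und ⊆ ent` the tail weight factors as
`tailWtK ent W = tailWtK und W · tailWtK (ent \ und) W` (`tailWtK_sdiff`), so the tail-mixed values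
split into a CLOSED part (no coin of `und` open: the OR-tail with the entry set `ent \ und`) and an
OPEN part (some coin of `und` open: the sure values) — `rValK_split_sdiff`, `gValK_split_sdiff`.
The closed factor `tailWtK und` is log-MODULAR (`tailWtK_mul_eq`); the open factor
`1 − tailWtK und` is increasing, and it is log-supermodular on every pair of clusters whose
traces on `und` are NESTED (`open_mul_open_eq_of_sub`: then the meet and the join have the same
traces as the two clusters) — the «chain» hypothesis of §45: all uncovered entries on one root
path.  The mixed relations «closed at the meet, open at the join» hold for every pair
(`closed_mul_open_le'`, `open_mul_closed_le'`).
-/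

namespace Summit.Ventures.PercRepro2.Coin

open Classical

section ChainSplit

variable {V : Type*} {E : Type*} [DecidableEq V] {R : Type*} [Field R] [LinearOrder R]
  [IsStrictOrderedRing R]

omit [LinearOrder R] [IsStrictOrderedRing R] in
/-- The tail weight over a union of disjoint entry sets is the product. -/
lemma tailWtK_sdiff (pr : E → R) {ent und : Finset V} (c : V → E) (hund : und ⊆ ent)
    (W : Finset V) :
    tailWtK pr ent c W = tailWtK pr und c W * tailWtK pr (ent \ und) c W := by
  unfold tailWtK
  rw [mul_comm]
  exact (Finset.prod_sdiff hund).symm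

omit [LinearOrder R] [IsStrictOrderedRing R] in
/-- **The `R`-value splits at the entry set `und`.** -/
lemma rValK_split_sdiff (A : Finset V → R) (pr : E → R) {ent und : Finset V} (c : V → E) (a : V)
    (hund : und ⊆ ent) (W : Finset V) :
    rValK A pr ent c a W =
      tailWtK pr und c W * rValK A pr (ent \ und) c a W +
        (1 - tailWtK pr und c W) * A (W ∪ {a}) := by
  unfold rValK
  rw [tailWtK_sdiff pr c hund W]
  ring

omit [LinearOrder R] [IsStrictOrderedRing R] in
/-- **The gate value splits at the entry set `und`.** -/
lemma gValK_split_sdiff (A : Finset V → R) (pr : E → R) {ent und : Finset V} (c : V → E)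
    (a w : V) (hund : und ⊆ ent) (W : Finset V) :
    gValK A pr ent c a w W =
      tailWtK pr und c W * gValK A pr (ent \ und) c a w W +
        (1 - tailWtK pr und c W) * A (W ∪ {a, w}) := by
  unfold gValK
  rw [tailWtK_sdiff pr c hund W]
  ring

omit [LinearOrder R] [IsStrictOrderedRing R] in
/-- The tail weight is log-modular: `tw(s)·tw(t) = tw(s ∩ t)·tw(s ∪ t)`. -/
lemma tailWtK_mul_eq (pr : E → R) (ent : Finset V) (c : V → E) (s t : Finset V) :
    tailWtK pr ent c s * tailWtK pr ent c t =
      tailWtK pr ent c (s ∩ t) * tailWtK pr ent c (s ∪ t) := by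
  unfold tailWtK
  rw [← Finset.prod_mul_distrib, ← Finset.prod_mul_distrib]
  exact Finset.prod_congr rfl fun r _ => coinClosed_mul_coinClosed (pr (c r)) r s t

omit [LinearOrder R] [IsStrictOrderedRing R] in
/-- The tail weight depends on the cluster only through its trace on the entry set. -/
lemma tailWtK_congr (pr : E → R) (ent : Finset V) (c : V → E) {s t : Finset V}
    (h : ∀ r ∈ ent, r ∈ s ↔ r ∈ t) : tailWtK pr ent c s = tailWtK pr ent c t := by
  unfold tailWtK
  exact Finset.prod_congr rfl fun r hr => by simp only [h r hr]

/-- The open factor `1 − tw` is nonnegative. -/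
lemma open_nonneg {pr : E → R} (hp0 : ∀ e, 0 ≤ pr e) (hp1 : ∀ e, pr e ≤ 1) (ent : Finset V)
    (c : V → E) (W : Finset V) : 0 ≤ 1 - tailWtK pr ent c W :=
  sub_nonneg.2 (tailWtK_le_one hp0 hp1 ent c W)

omit [LinearOrder R] [IsStrictOrderedRing R] in
/-- **Open × open on a NESTED pair** (the trace of `s` on `und` inside that of `t`): the meet has
the trace of `s`, the join that of `t`, so the product is unchanged. -/
lemma open_mul_open_eq_of_sub (pr : E → R) (und : Finset V) (c : V → E) {s t : Finset V}
    (hst : ∀ r ∈ und, r ∈ s → r ∈ t) :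
    (1 - tailWtK pr und c s) * (1 - tailWtK pr und c t) =
      (1 - tailWtK pr und c (s ∩ t)) * (1 - tailWtK pr und c (s ∪ t)) := by
  have h1 : tailWtK pr und c (s ∩ t) = tailWtK pr und c s :=
    tailWtK_congr pr und c fun r hr => by
      simp only [Finset.mem_inter]
      exact ⟨fun h => h.1, fun h => ⟨h, hst r hr h⟩⟩
  have h2 : tailWtK pr und c (s ∪ t) = tailWtK pr und c t :=
    tailWtK_congr pr und c fun r hr => by
      simp only [Finset.mem_union]
      exact ⟨fun h => h.elim (hst r hr) id, fun h => Or.inr h⟩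
  rw [h1, h2]

/-- **Closed × open ≤ closed at the meet × open at the join** (both factors antitone). -/
lemma closed_mul_open_le' {pr : E → R} (hp0 : ∀ e, 0 ≤ pr e) (hp1 : ∀ e, pr e ≤ 1)
    (und : Finset V) (c : V → E) (s t : Finset V) :
    tailWtK pr und c s * (1 - tailWtK pr und c t) ≤
      tailWtK pr und c (s ∩ t) * (1 - tailWtK pr und c (s ∪ t)) := by
  have h1 : tailWtK pr und c s ≤ tailWtK pr und c (s ∩ t) :=
    tailWtK_anti hp0 hp1 und c (Finset.inter_subset_left : s ∩ t ⊆ s)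
  have h2 : 1 - tailWtK pr und c t ≤ 1 - tailWtK pr und c (s ∪ t) := by
    have := tailWtK_anti hp0 hp1 und c (Finset.subset_union_right : t ⊆ s ∪ t)
    linarith
  exact mul_le_mul h1 h2 (open_nonneg hp0 hp1 und c t) (tailWtK_nonneg hp1 und c _)

/-- **Open × closed ≤ closed at the meet × open at the join.** -/
lemma open_mul_closed_le' {pr : E → R} (hp0 : ∀ e, 0 ≤ pr e) (hp1 : ∀ e, pr e ≤ 1)
    (und : Finset V) (c : V → E) (s t : Finset V) :
    (1 - tailWtK pr und c s) * tailWtK pr und c t ≤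
      tailWtK pr und c (s ∩ t) * (1 - tailWtK pr und c (s ∪ t)) := by
  have h1 : tailWtK pr und c t ≤ tailWtK pr und c (s ∩ t) :=
    tailWtK_anti hp0 hp1 und c (Finset.inter_subset_right : s ∩ t ⊆ t)
  have h2 : 1 - tailWtK pr und c s ≤ 1 - tailWtK pr und c (s ∪ t) := by
    have := tailWtK_anti hp0 hp1 und c (Finset.subset_union_left : s ⊆ s ∪ t)
    linarith
  calc (1 - tailWtK pr und c s) * tailWtK pr und c t
      = tailWtK pr und c t * (1 - tailWtK pr und c s) := by ring
    _ ≤ tailWtK pr und c (s ∩ t) * (1 - tailWtK pr und c (s ∪ t)) :=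
        mul_le_mul h1 h2 (open_nonneg hp0 hp1 und c s) (tailWtK_nonneg hp1 und c _)

omit [LinearOrder R] [IsStrictOrderedRing R] in
/-- Open × open is log-supermodular on a pair whose traces on `und` are nested either way. -/
lemma open_mul_open_le_of_chain [LinearOrder R] (pr : E → R) (und : Finset V) (c : V → E)
    {s t : Finset V} (h : (∀ r ∈ und, r ∈ s → r ∈ t) ∨ (∀ r ∈ und, r ∈ t → r ∈ s)) :
    (1 - tailWtK pr und c s) * (1 - tailWtK pr und c t) ≤
      (1 - tailWtK pr und c (s ∩ t)) * (1 - tailWtK pr und c (s ∪ t)) := by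
  rcases h with h | h
  · exact le_of_eq (open_mul_open_eq_of_sub pr und c h)
  · have e := open_mul_open_eq_of_sub pr und c h
    rw [Finset.inter_comm, Finset.union_comm, mul_comm] at e
    exact le_of_eq e

end ChainSplit

end Summit.Ventures.PercRepro2.Coin
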